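import Literature.AnabelianGeometry.EtaleTheta.GalSectIntegralStructures
import Literature.AnabelianGeometry.EtaleTheta.Thm16SubdagTransport
import HarnessLib

/-!
# [EtTh] §1, Prop. 1.5 (iii): the inversion-automorphism clause — typed at the root (additive predicates)

Mochizuki, *The étale theta function and its Frobenioid-theoretic manifestations*, Publ. RIMS **45**
(2009), §1, Prop. 1.5 (iii), PRIMS PDF p. 23 l. 84–92 (printed p. 249); proof of Thm. 1.6 (iii), PDF p. 25
l. 15–38 [cite: MochizukiEtTh2009, Prop 1.5 (iii) p.23]. abc-iut cell, layer L2, seat abc-iut-L2-t1 (the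
§1 ROOT owner); sub-DAG debt R14-ι / residual G-K3-1 of `plan/L2/K3-RESIDUAL-GAPS.md` («WHAT A ROOT TYPING
WOULD ADD»). CLASS (c): ADDITIVE named predicates over the FROZEN root (`Setting.lean` v3,
`ThetaCohomology.lean`, `TemperedRigidity.lean`); no field of a frozen structure is touched, nothing asserted.

PRINT (p. 23, both renders — kurims p. 22 l. 1–5 and PRIMS p. 23 l. 84–92 — read «Π^tp_Y», not «Π^tp_Ÿ»):
«Similarly, any inversion automorphism ι of Π^tp_Y — i.e., an automorphism lying over the action of “−1” on
the underlying elliptic curve of X^log which fixes the irreducible component of the special fiber of Y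
labeled 0 — fixes η̈^Θ + log(O^×_K̈), but maps log(Ü) + log(O^×_K̈) to −log(Ü) + log(O^×_K̈).»

## How it is typed (read with the referee)

* `ThetaSetting.IsInversionAut D ι` — «an automorphism lying over the action of “−1” on the underlying
  elliptic curve of X^log»: a topological automorphism `ι` of `Π^tp_X` (every automorphism of `X^log` over
  `K` acts on `Π^tp_X` up to inner automorphisms; we extend `ι` from `Π^tp_Y` to `Π^tp_X` as print does in
  the proof of Thm. 1.6 (iii), p. 25 l. 16 «composing γ with an appropriate inner automorphism of
  Π^tp_{Xβ}») recorded through the group-theoretic shadows of that origin which §1 uses: over `K`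
  (`aug ∘ ι = aug`), acting by `−1` on `Z = Π^tp_X/Π^tp_Y = Gal(Y/X)` (the deck translations of the chain of
  components are conjugated to their inverses by the reflection) and on `(Δ^tp_Y)^ell ≅ Ẑ(1)` (the Tate
  module of the elliptic curve, on which `[−1]` acts by `−1`), and preserving the coverings `Y_N → Y`,
  `Z_N → Y_N` of pp. 13–14 (functorial in `X^log`). NOT a characterisation: that every such automorphism is
  geometric is [SemiAnbd] Thm. 6.4-type absolute anabelian geometry (layer L3), not claimed here.
* `ThetaSetting.FixesCuspBelow ι y` + `CuspidalPointDd.IsOnLabelZero y` — «which fixes the irreducible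
  component of the special fiber of Y labeled 0»: the interface has no carrier for irreducible components;
  the ONLY datum linking the labelling used by `η̈^Θ` to `Π^tp_X` is a cuspidal point `y` of `Ÿ`
  (`ThetaSetting.CuspidalPointDd`, abc-iut-w5-d062) with its coordinate `Ü(y) = ±q̈^a` — `y` lies over the
  component of `Y` labelled `a` (the cusps of `Ÿ` are the zeros `±q̈^a` of `Θ̈`, Prop. 1.4 (i); each component
  of `Y` carries exactly one cusp of `Y`); so «fixes the component labeled 0» is typed as print's own gloss in
  the proof of Thm. 1.6 (iii), p. 25 l. 33–34 «a cusp that maps to the irreducible component of the special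
  fiber of Ÿ labeled 0 [e.g., a cusp that is preserved by the inversion automorphism]»: `ι(D_y)` is
  `Π^tp_Y`-conjugate to `D_y` for a `y` with `Ü(y) = ±1`.
* `ThetaSetting.Prop15iiiInv E hC` — the two displayed identities, for every such `ι` equipped with a theta
  companion (`ThetaSetting.ThetaCompanion`, the induced automorphism of `(Π^tp_X)^Θ`; derivable under R3
  `IsQuotientMap toTheta` by abc-iut-L6-d5's `Thm16Sub.thetaCompanion_of_isQuotientMap`): (1) on
  `H¹(Π^tp_Ÿ, Δ_Θ)` the transport along `ι` (`ThetaSetting.transport`, `TemperedRigidity.lean`) maps the torsor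
  `O^×_K̈ · η̈^Θ = E.thetaClasses` onto itself; (2) on `H¹((Π^tp_Ÿ)^Θ, Δ_Θ)` the induced action `T` (ANY
  intertwiner `infl ∘ T = transport ∘ infl` — it exists and is unique, abc-iut-L6-d5
  `Thm16Sub.exists_thetaTransportEquiv` / `thetaTransportEquiv_unique`) sends `log(Ü)` to
  `−log(Ü) + log(u)`, `u ∈ O^×_K̈`. The Θ-level form of (1) for the unique lifts of Prop. 1.5 (iii) is PROVED
  from (1) (`Prop15iiiInv.thetaLift_fixed`).
* `ThetaSetting.InvNegatesFdd1Quot hC ι hι cι` — the COMBINED reading of Prop. 1.5 (ii) «F̈¹/F̈² = Ẑ·log(Ü)»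
  and (iii): `ι` acts by `−1` on `F̈¹/F̈²` (`∀ d ∈ F̈¹, T d · d ∈ F̈²`) — exactly the binder `hιF1` of the K3
  capstone `Thm16Sub.thm16iii_of_printedClauses_inversion`; kept SEPARATE from `Prop15iiiInv` because print
  states (iii) for the element `log(Ü)` only and the passage to all of `F̈¹` uses the `Ẑ`-module structure of
  (ii), which the tree's `H¹` does not carry (residual G-K3-2).
HONEST FRAMING: [EtTh] is refereed; nothing here is asserted or bears on [IUTchIII] Cor. 3.12; typed ≠ proved.
-/

noncomputable section

namespace Literature.AnabelianGeometry.EtaleTheta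

open Literature.AnabelianGeometry.SemiGraphs

namespace ThetaSetting

variable {p : ℕ} [Fact p.Prime] {D : ThetaSetting p}

/-! ### Inversion automorphisms (Prop. 1.5 (iii), p. 23) -/

/-- **An inversion automorphism** (Prop. 1.5 (iii), p. 23: «an automorphism lying over the action of “−1”
on the underlying elliptic curve of X^log»), as a topological automorphism `ι` of `Π^tp_X` with the
group-theoretic shadows of that geometric origin: `ι` lies over `K` (commutes with the augmentation), acts by
`−1` on `Z = Π^tp_X/Π^tp_Y` («the natural action of Z on Y», p. 12: the reflection of the chain of components
inverts the deck translations) and on `(Δ^tp_X)^ell = Δ^ab` (p. 12, the Tate module of the elliptic curve, on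
which `[−1]` acts by `−1`), and preserves the coverings `Y_N → Y`, `Z_N → Y_N` (pp. 13–14, functorial in `X^log`). The
normalisation «which fixes the irreducible component … labeled 0» is `FixesCuspBelow` below.
[cite: MochizukiEtTh2009, Prop 1.5 (iii) p.23] -/
structure IsInversionAut (D : ThetaSetting p) (ι : D.PiTemp ≃ₜ* D.PiTemp) : Prop where
  /-- `ι` lies over `K`: it commutes with `Π^tp_X → G_K`. -/
  aug_apply : ∀ g : D.PiTemp, D.aug (ι g) = D.aug g
  /-- `ι` acts by `−1` on `Z = Π^tp_X/Π^tp_Y`. -/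
  toZ_apply : ∀ g : D.PiTemp, D.toZ (ι g) = (D.toZ g)⁻¹
  /-- `ι` acts by `−1` on `(Δ^tp_X)^ell` («`Δ^ell_X := Δ^ab_X`», p. 12 — the Tate module of the elliptic
  curve, an extension of `Z ⊗ Ẑ` by `(Δ^tp_Y)^ell ≅ Ẑ(1)`, on which `[−1]` acts by `−1`). -/
  ell_apply : ∀ g ∈ D.DeltaTemp, D.thetaToEll (D.toTheta (ι g)) = (D.thetaToEll (D.toTheta g))⁻¹
  /-- `ι` preserves `Π^tp_{Y_N}` (`Y_N → Y`, p. 13). -/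
  map_GtpYN : ∀ N, (D.GtpYN N).map ι.toMulEquiv.toMonoidHom = D.GtpYN N
  /-- `ι` preserves `Π^tp_{Z_N}` (`Z_N → Y_N`, p. 14). -/
  map_GtpZN : ∀ N, (D.GtpZN N).map ι.toMulEquiv.toMonoidHom = D.GtpZN N

namespace IsInversionAut

variable {ι : D.PiTemp ≃ₜ* D.PiTemp}

/-- A subgroup pulled back from `G_{ℚ_p}` is preserved by an automorphism over `K`.
[cite: MochizukiEtTh2009, Prop 1.5 (iii) p.23] -/
theorem map_comap_aug (hι : D.IsInversionAut ι) (S : Subgroup (GQp p)) :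
    (S.comap D.aug.toMonoidHom).map ι.toMulEquiv.toMonoidHom = S.comap D.aug.toMonoidHom := by
  ext x
  constructor
  · rintro ⟨y, hy, rfl⟩
    change D.aug (ι y) ∈ S
    rw [hι.aug_apply]
    exact hy
  · intro hx
    refine ⟨ι.symm x, ?_, ι.apply_symm_apply x⟩
    change D.aug (ι.symm x) ∈ S
    have h := hι.aug_apply (ι.symm x)
    rw [ι.apply_symm_apply] at h
    rw [← h]
    exact hx

/-- An inversion automorphism preserves `Δ^tp_X = Ker(Π^tp_X → G_K)`.
[cite: MochizukiEtTh2009, Prop 1.5 (iii) p.23] -/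
theorem map_deltaTemp (hι : D.IsInversionAut ι) :
    D.DeltaTemp.map ι.toMulEquiv.toMonoidHom = D.DeltaTemp :=
  hι.map_comap_aug ⊥

/-- An inversion automorphism preserves `Π^tp_Y` (`= Π^tp_{Y₁}`).
[cite: MochizukiEtTh2009, Prop 1.5 (iii) p.23] -/
theorem map_GtpY (hι : D.IsInversionAut ι) : D.GtpY.map ι.toMulEquiv.toMonoidHom = D.GtpY := by
  change D.toZ.ker.map _ = D.toZ.ker
  rw [← D.GtpYN_one]
  exact hι.map_GtpYN 1

/-- An inversion automorphism preserves `Π^tp_{Ÿ_N}`. [cite: MochizukiEtTh2009, Prop 1.5 (iii) p.23] -/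
theorem map_GtpYddN (hι : D.IsInversionAut ι) (N : ℕ+) :
    (D.GtpYddN N).map ι.toMulEquiv.toMonoidHom = D.GtpYddN N := by
  change (D.GtpYN (2 * N) ⊓ (D.GJddN N).comap D.aug.toMonoidHom).map _ = _
  rw [Subgroup.map_inf_eq _ _ _ ι.injective, hι.map_GtpYN, hι.map_comap_aug]
  rfl

/-- An inversion automorphism satisfies Thm. 1.6 (i): `ι(Π^tp_Ÿ) = Π^tp_Ÿ` — so the transport of classes
along `ι` (`ThetaSetting.transport`) is available. [cite: MochizukiEtTh2009, Thm 1.6 (i) p.24] -/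
theorem thm16i (hι : D.IsInversionAut ι) : Thm16i ι :=
  hι.map_GtpYddN 1

/-- If `ι` preserves a subgroup then so does `ι⁻¹`. [cite: MochizukiEtTh2009, Prop 1.5 (iii) p.23] -/
theorem map_symm_eq_of_map_eq {H : Subgroup D.PiTemp} (h : H.map ι.toMulEquiv.toMonoidHom = H) :
    H.map ι.symm.toMulEquiv.toMonoidHom = H := by
  conv_lhs => rw [← h]
  rw [Subgroup.map_map]
  convert Subgroup.map_id _
  ext x
  exact ι.symm_apply_apply x

/-- The inverse of an inversion automorphism is an inversion automorphism.
[cite: MochizukiEtTh2009, Prop 1.5 (iii) p.23] -/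
theorem symm (hι : D.IsInversionAut ι) : D.IsInversionAut ι.symm where
  aug_apply g := by
    have h := hι.aug_apply (ι.symm g)
    rw [ι.apply_symm_apply] at h
    exact h.symm
  toZ_apply g := by
    have h := hι.toZ_apply (ι.symm g)
    rw [ι.apply_symm_apply] at h
    rw [← inv_inv (D.toZ g), h, inv_inv, inv_inv]
  ell_apply g hg := by
    have hg' : ι.symm g ∈ D.DeltaTemp := by
      have h2 : ι.symm g ∈ D.DeltaTemp.map ι.symm.toMulEquiv.toMonoidHom := ⟨g, hg, rfl⟩
      rwa [map_symm_eq_of_map_eq hι.map_deltaTemp] at h2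
    have h := hι.ell_apply (ι.symm g) hg'
    rw [ι.apply_symm_apply] at h
    rw [← inv_inv (D.thetaToEll (D.toTheta g)), h, inv_inv, inv_inv]
  map_GtpYN N := map_symm_eq_of_map_eq (hι.map_GtpYN N)
  map_GtpZN N := map_symm_eq_of_map_eq (hι.map_GtpZN N)

end IsInversionAut

/-! ### «which fixes the irreducible component of the special fiber of Y labeled 0» -/

/-- A cuspidal point `y` of `Ÿ` **lies over the irreducible component of `Y` labelled `0`**: its coordinate
is `Ü(y) = ±1` (the cusps of `Ÿ` are `Ü = ±q̈^a`, `a ∈ Z`, the two over the component labelled `a` being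
`±q̈^a`; Prop. 1.4 (i), p. 22; labelling p. 12). [cite: MochizukiEtTh2009, Thm 1.6 (iii) p.25] -/
def CuspidalPointDd.IsOnLabelZero {E : D.KummerData} (y : CuspidalPointDd E) : Prop :=
  ((y.coord : D.Kdd) : PadicAlgCl p) = 1 ∨ ((y.coord : D.Kdd) : PadicAlgCl p) = -1

/-- **`ι` fixes the cusp of `Y` below `y`** («a cusp that is preserved by the inversion automorphism», proof
of Thm. 1.6 (iii), p. 25 l. 34): `ι(D_y)` is `Π^tp_Y`-conjugate to `D_y` (the decomposition groups, in
`Π^tp_Ÿ`, of the cusps of `Ÿ` over one cusp of `Y` form one `Π^tp_Y`-conjugacy class). For `y` over the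
component labelled `0` this is print's «fixes the irreducible component of the special fiber of Y labeled 0»
(each component of `Y` carries exactly one cusp of `Y`). [cite: MochizukiEtTh2009, Prop 1.5 (iii) p.23] -/
def FixesCuspBelow (ι : D.PiTemp ≃ₜ* D.PiTemp) {E : D.KummerData} (y : CuspidalPointDd E) : Prop :=
  ∃ h ∈ D.GtpY, y.Dpt.map ι.toMulEquiv.toMonoidHom = y.Dpt.map (MulAut.conj h).toMonoidHom

/-! ### The clause itself -/

/-- The two displayed identities of Prop. 1.5 (iii) for ONE inversion automorphism `ι` with theta companion
`cι`: (1) «fixes η̈^Θ + log(O^×_K̈)» — the transport along `ι` maps the torsor `O^×_K̈ · η̈^Θ ⊆ H¹(Π^tp_Ÿ, Δ_Θ)`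
onto itself; (2) «maps log(Ü) + log(O^×_K̈) to −log(Ü) + log(O^×_K̈)» — for the induced action `T` on
`H¹((Π^tp_Ÿ)^Θ, Δ_Θ)` (any intertwiner of the transport through inflation). [cite: MochizukiEtTh2009, Prop 1.5 (iii) p.23] -/
structure InvClauses (E : D.EtaleThetaData) {ι : D.PiTemp ≃ₜ* D.PiTemp} (hι : D.IsInversionAut ι)
    (cι : ThetaCompanion ι) : Prop where
  /-- «fixes η̈^Θ + log(O^×_K̈)». -/
  image_thetaClasses : transport cι hι.thm16i '' E.thetaClasses = E.thetaClasses
  /-- «maps log(Ü) + log(O^×_K̈) to −log(Ü) + log(O^×_K̈)». -/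
  logUdd_inv : ∀ T : D.H1Theta (D.GtpYdd.map D.toTheta) ≃* D.H1Theta (D.GtpYdd.map D.toTheta),
    (∀ z, D.inflTheta D.GtpYdd (T z) = transport cι hι.thm16i (D.inflTheta D.GtpYdd z)) →
      ∃ u ∈ D.unitsOKdd, T E.logUdd = E.logUdd⁻¹ * E.kumYdd (E.toKddHat u)

/-- **[EtTh] Prop. 1.5 (iii), inversion clause** (p. 23): «any inversion automorphism ι … which fixes the
irreducible component of the special fiber of Y labeled 0 … fixes η̈^Θ + log(O^×_K̈), but maps
log(Ü) + log(O^×_K̈) to −log(Ü) + log(O^×_K̈)» — for every inversion automorphism `ι` of `Π^tp_X` (with a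
theta companion) fixing the cusp of `Y` below some cuspidal point of `Ÿ` over the component labelled `0`.
Companion of `Prop15iii` (the `Z`-action clause, `ThetaCohomology.lean`). [cite: MochizukiEtTh2009, Prop 1.5 (iii) p.23] -/
def Prop15iiiInv (E : D.EtaleThetaData) : Prop :=
  ∀ (ι : D.PiTemp ≃ₜ* D.PiTemp) (hι : D.IsInversionAut ι) (cι : ThetaCompanion ι)
    (y : CuspidalPointDd E.toKummerData), y.IsOnLabelZero → D.FixesCuspBelow ι y → InvClauses E hι cι

/-- **Prop. 1.5 (ii) ∧ (iii), combined reading**: `ι` acts by `−1` on `F̈¹/F̈² = Ẑ · log(Ü)` — for the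
induced action `T` on `H¹((Π^tp_Ÿ)^Θ, Δ_Θ)`, `T(d) · d ∈ F̈²` for every `d ∈ F̈¹`. This is the shape bound as
`hιF1` by `Thm16Sub.thm16iii_of_printedClauses_inversion` (K3 capstone); it follows in print from (iii) for the
generator `log(Ü)` and the `Ẑ`-module identification of (ii) (residual G-K3-2; the tree's `H¹` carries no
`Ẑ`-action), and independently from `IsInversionAut.ell_apply` (`−1` on `(Δ^tp_Ÿ)^ell`) once restriction to
`(Δ^tp_Ÿ)^Θ` is identified with `Hom((Δ^tp_Ÿ)^ell, Δ_Θ)` — neither derivation is claimed here.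
[cite: MochizukiEtTh2009, Prop 1.5 (iii) p.23] -/
def InvNegatesFdd1Quot (hC : D.Compat) {ι : D.PiTemp ≃ₜ* D.PiTemp} (hι : D.IsInversionAut ι)
    (cι : ThetaCompanion ι) : Prop :=
  ∀ T : D.H1Theta (D.GtpYdd.map D.toTheta) ≃* D.H1Theta (D.GtpYdd.map D.toTheta),
    (∀ z, D.inflTheta D.GtpYdd (T z) = transport cι hι.thm16i (D.inflTheta D.GtpYdd z)) →
      ∀ d ∈ Fdd1 hC, T d * d ∈ (Fdd2 : Subgroup (D.H1Theta (D.GtpYdd.map D.toTheta)))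

/-! ### Consequences (PROVED): the Θ-level form of clause (1) -/

/-- Clause (1) at the level of `H¹(Π^tp_Ÿ, Δ_Θ)`, pointwise: the transport along `ι` of a theta class is a
theta class. [cite: MochizukiEtTh2009, Prop 1.5 (iii) p.23] -/
theorem InvClauses.transport_mem {E : D.EtaleThetaData} {ι : D.PiTemp ≃ₜ* D.PiTemp}
    {hι : D.IsInversionAut ι} {cι : ThetaCompanion ι} (h : InvClauses E hι cι)
    {x : D.H1 D.GtpYdd} (hx : x ∈ E.thetaClasses) : transport cι hι.thm16i x ∈ E.thetaClasses := by
  rw [← h.image_thetaClasses]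
  exact ⟨x, hx, rfl⟩

/-- **Clause (1) at the Θ-level** («fixes η̈^Θ + log(O^×_K̈)» for the classes `η̈^Θ ∈ H¹((Π^tp_Ÿ)^Θ, Δ_Θ)` of
Prop. 1.5 (iii), «by abuse of notation»): for any lift `x′` of a theta class `x` and the induced action `T`,
`T x′ = x′ · κ(u)` for a unit `u ∈ O^×_K̈` — PROVED from clause (1) and the injectivity of inflation
(`inflTheta_injective`, abc-iut-L2-t12), the transported class `ι·x = k · x` having the lift `κ(u) · x′`.
This is the shape of the binders `hιx`/`hιy` of the K3 capstone at `γ = id`. [cite: MochizukiEtTh2009, Prop 1.5 (iii) p.23] -/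
theorem InvClauses.thetaLift_fixed {E : D.EtaleThetaData} {ι : D.PiTemp ≃ₜ* D.PiTemp}
    {hι : D.IsInversionAut ι} {cι : ThetaCompanion ι} (h : InvClauses E hι cι)
    (T : D.H1Theta (D.GtpYdd.map D.toTheta) ≃* D.H1Theta (D.GtpYdd.map D.toTheta))
    (hT : ∀ z, D.inflTheta D.GtpYdd (T z) = transport cι hι.thm16i (D.inflTheta D.GtpYdd z))
    {x : D.H1 D.GtpYdd} (hx : x ∈ E.thetaClasses) (x' : D.H1Theta (D.GtpYdd.map D.toTheta))
    (hx' : D.inflTheta D.GtpYdd x' = x) :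
    ∃ u ∈ D.unitsOKdd, ∃ v ∈ D.unitsOKdd,
      x = D.inflTheta D.GtpYdd (E.kumYdd (E.toKddHat v)) * E.etaDd ∧
      T x' = x' * E.kumYdd (E.toKddHat u) := by
  obtain ⟨k, hk, hxk⟩ := hx
  obtain ⟨k', hk', hTx⟩ := h.transport_mem ⟨k, hk, hxk⟩
  -- unpack the unit classes `k = infl κ(v)`, `k' = infl κ(w)`
  obtain ⟨cv, ⟨v, hv, rfl⟩, rfl⟩ := hk
  obtain ⟨cw, ⟨w, hw, rfl⟩, rfl⟩ := hk'
  refine ⟨w * v⁻¹, mul_mem hw (inv_mem hv), v, hv, hxk, ?_⟩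
  have key : D.inflTheta D.GtpYdd (T x') =
      D.inflTheta D.GtpYdd (x' * E.kumYdd (E.toKddHat (w * v⁻¹))) := by
    rw [hT, hx', hTx, map_mul (D.inflTheta D.GtpYdd) x', hx', hxk]
    simp only [map_mul, map_inv, MonoidHom.comp_apply]
    rw [mul_comm (D.inflTheta D.GtpYdd (E.kumYdd (E.toKddHat v))) E.etaDd, mul_assoc,
      mul_left_comm (D.inflTheta D.GtpYdd (E.kumYdd (E.toKddHat v))), mul_inv_cancel, mul_one,
      mul_comm]
  exact D.inflTheta_injective D.GtpYdd key

/-- **Junction with Thm. 1.6 (iii).** The normalisation-free shadow of clause (1) — «maps the classes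
O^×·η̈^Θ to some Π^tp_X/Π^tp_Y ≅ Z-conjugate of O^×·η̈^Θ» — is the typed Thm. 1.6 (iii) at `γ = ι`, `α = β`
(`ThetaSetting.Thm16iii ι _ cι E E hC`); clause (1) is the case `σ = 1` of it, PROVED here (for an inversion
automorphism fixing the component labelled `0` no `Z`-conjugation is needed). [cite: MochizukiEtTh2009, Thm 1.6 (iii) p.24] -/
theorem InvClauses.thm16iii_self {E : D.EtaleThetaData} {ι : D.PiTemp ≃ₜ* D.PiTemp}
    {hι : D.IsInversionAut ι} {cι : ThetaCompanion ι} (h : InvClauses E hι cι) (hC : D.Compat) :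
    Thm16iii ι hι.thm16i cι E E hC := by
  refine ⟨1, ?_⟩
  rw [h.image_thetaClasses]
  ext x
  simp only [Set.mem_image, ContH1.conj_one_apply, exists_eq_right]

/-! ### Anchored cusp data (appended v2): guarding the normalisation against re-coordinatisation -/

/-- A cuspidal point datum `y` is **anchored**: its evaluation map is injective («H¹(G_L, Δ_Θ) ≅ H¹(G_L, Ẑ(1))
≅ (L^×)^∧», Prop. 1.4 (iii), p. 22) and the Kummer class `log(Ü)` of the coordinate function (`KummerData.logUdd`,
«the Kummer class of … Ü ∈ Γ(Ü, O^×_Ü)», p. 21), restricted to the section `s(G_K̈) ≤ D_y`, evaluates to the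
coordinate `Ü(y)` of the cusp — the two printed sentences that tie `coord` to `(D_y, s, evalAt)` (the cusp
analogue of `ThetaSetting.AnchoredPoint`, abc-iut-L2-t1 g4, `ThetaCohomologyAnchored.lean`). WHY: in
`CuspidalPointDd` (as in `NonCuspidalPoint`, finding F-d1g4-1 / F-w5d140-3) the coordinate is independent DATA,
so `IsOnLabelZero` constrains `D_y` only for anchored data; un-anchored, `(D_y, coord := 1)` is a term for a cusp
on ANY component and `Prop15iiiInv` would inherit the defect of F-0590. [cite: MochizukiEtTh2009, Prop 1.4 (iii) p.22] -/
structure CuspidalPointDd.IsAnchored {E : D.KummerData} (y : CuspidalPointDd E) : Prop where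
  /-- The evaluation `H¹(s(G_K̈), Δ_Θ) → (K̈^×)^∧` is injective. -/
  evalAt_injective : Function.Injective y.evalAt
  /-- `log(Ü)|_y = Ü(y)`: the class of the coordinate function evaluates at the cusp to its coordinate. -/
  evalAt_logUdd : y.evalAt (ContH1.res D.toTheta D.DeltaTheta (y.sec_le.trans y.Dpt_le)
    (D.inflTheta D.GtpYdd E.logUdd)) = E.toKddHat y.coord

/-- **[EtTh] Prop. 1.5 (iii), inversion clause — ANCHORED form** (the form consumers should bind): as
`Prop15iiiInv`, the normalising cusp datum being anchored (`CuspidalPointDd.IsAnchored`), so that «over the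
component labelled 0» (`IsOnLabelZero`, `Ü(y) = ±1`) is a property of the cusp `D_y` and not of a free
coordinate. Implied by `Prop15iiiInv` (`prop15iiiInvAnchored_of_prop15iiiInv`). [cite: MochizukiEtTh2009, Prop 1.5 (iii) p.23] -/
def Prop15iiiInvAnchored (E : D.EtaleThetaData) : Prop :=
  ∀ (ι : D.PiTemp ≃ₜ* D.PiTemp) (hι : D.IsInversionAut ι) (cι : ThetaCompanion ι)
    (y : CuspidalPointDd E.toKummerData), y.IsAnchored → y.IsOnLabelZero → D.FixesCuspBelow ι y →
      InvClauses E hι cι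

/-- The anchored form is a weakening of `Prop15iiiInv`. [cite: MochizukiEtTh2009, Prop 1.5 (iii) p.23] -/
theorem prop15iiiInvAnchored_of_prop15iiiInv {E : D.EtaleThetaData} (h : D.Prop15iiiInv E) :
    D.Prop15iiiInvAnchored E :=
  fun ι hι cι y _ h0 hfix => h ι hι cι y h0 hfix

/-- For an anchored cusp datum the coordinate is determined by `(D_y, s, evalAt)`: two anchored data with the
same evaluation of restricted classes have the same coordinate (so re-coordinatisation is no longer a term of the type
with the same group data). [cite: MochizukiEtTh2009, Prop 1.4 (iii) p.22] -/
theorem CuspidalPointDd.IsAnchored.coord_eq_of_eq {E : D.KummerData} {y y' : CuspidalPointDd E}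
    (hy : y.IsAnchored) (hy' : y'.IsAnchored)
    (heval : ∀ (z : D.H1 D.GtpYdd),
      y.evalAt (ContH1.res D.toTheta D.DeltaTheta (y.sec_le.trans y.Dpt_le) z) =
        y'.evalAt (ContH1.res D.toTheta D.DeltaTheta (y'.sec_le.trans y'.Dpt_le) z)) :
    y.coord = y'.coord := by
  apply E.toKddHat_injective
  rw [← hy.evalAt_logUdd, ← hy'.evalAt_logUdd]
  exact heval _

end ThetaSetting

end Literature.AnabelianGeometry.EtaleTheta

end
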